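import Summits.ValiantsHypothesis.ValiantsHypothesis.Theorems.LacunarySymmetroidMatrixDescartesCensusDoorA34SheetTwistedBlocks
import Summits.ValiantsHypothesis.ValiantsHypothesis.Theorems.LacunarySymmetroidMatrixDescartesCensusDoorA34SheetSemidefPairLaw
import Summits.ValiantsHypothesis.ValiantsHypothesis.Theorems.LacunarySymmetroidMatrixDescartesCensusDoorA34SheetWindowGramPrinciple
import Summits.ValiantsHypothesis.ValiantsHypothesis.Theorems.LacunarySymmetroidMatrixDescartesCensusBlockCone

/-!
# `MatrixDescartes` census — DOOR A at `(3,4)`: ALL FOUR TWISTED LETTER WINDOWS OF A NULL-TOP EIGHTEEN ARE GRAM-ORIENTED —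
# the sheet certificate of …SheetTwistedMiddleGram (middle window, `k = 3`) extended to the bottom window `k = 0` and the two long windows `k = 1, 2`

HONEST FRAMING.  Object-search cell `pub-symmetroid`, engine seat `val-sym-eng-2` (g12); helper rows beside the registered strata line
`Cruxes/DoorA34/Lines/strata.lean` on stmt-ValiantsHypothesis-19980 (`DoorA34 = PosRootLawAt 3 4 18`: OPEN, typed, never asserted here), second stub
`stub_nullTopCeiling` (`det S₃ = 0 ⇒ ≤ 17`), OPEN on the generic sheet `tr(adj S₃·S₂) ≠ 0`.  Third file of the seat's chain «Rolle twists ⇒ Descartes-sharp sub-word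
⇒ Gram orientation principle»: …SheetTwistedMiddleGram (p725357) did the MIDDLE window `{3,i,j}` of the sheet, …TwistedLetterWindows (p725586) the four letter
windows of a full-support NINETEEN; here g8's HEREDITY row `Census.twistedSubword_sharp_of_nullTop_eighteen` (every sub-word of the sheet word of an eighteen is
Descartes-sharp after twisting away the rest) gives the same for EVERY letter window `{k,p,p},{k,p,q},{k,q,q},{k,p,r},{k,q,r},{k,r,r}` of a null-top EIGHTEEN
(`k ∉ {p,q,r}`, so the absent slot `{3,3,3}` is never in the window; `d_q = d_p + a`, `d_r = d_p + b`, `0 < a < b`, `2a ≠ b`):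

* **`sheetLetterWindow_five_roots_of_nullTop_eighteen`** — `det S₃ = 0`, `18` distinct positive roots ⇒ the twisted `k`-window six-nomial (weights `W(n) = ∏ (n − σ(u))` over
  the exponents of the THIRTEEN sheet slots outside the window) has at least five distinct positive roots;
* **`sheetLetterWindow_gram_orientation_of_nullTop_eighteen`** (`2a < b`) / **`…_mirror`** (`b < 2a`) — hence it is Gram-ORIENTED (`0 < c̃₅Δ̃ ∧ c̃₀Δ̃ < 0 ∧ c̃₂Δ̃ < 0`,
  resp. `0 < c̃₀Δ̃ ∧ c̃₅Δ̃ < 0 ∧ c̃₂Δ̃ < 0`);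
* `sheetLetterWindow_coeffs_eq_traces_of_nullTop_eighteen` — the six window coefficients in letters (`coeff_square_of_nullTop_eighteen`, `coeff_mixed_of_nullTop_eighteen`);
* **`posRoots_le_17_of_nullTop_of_twistedLetterWindow_antiOriented`** / **`…_mirror`** — THE CERTIFICATE: a null-top pencil (sorted support, any real letters) whose
  twisted `k`-window, computed from the letters and `d` alone, is NOT Gram-oriented has at most `17` distinct positive roots — for each of the four letters `k`.
  For `k = 0` (bottom window, `(p,q,r) = (1,2,3)`, gaps `d₂−d₁`, `d₃−d₁`) and `k = 1, 2` (long windows through `d₃`) the shape is a WINDOW as soon as `d₃` exceeds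
  `d₁ + 2(d₂−d₁)`, resp. `d₀ + 2(d₂−d₀)`: on every window-ordered and every moderately-gapped support the stub is thus certified on the union of FOUR anti-oriented
  half-sheets.

LOCATED COMPANION (this seat, exact; report HOME/DOOR-A34-ENG2G12-REPORT.md §2–§3, tools work/census_gram.py, work/gramtwist.py): over the `(3,4)` census of record
(395 rows) EVERY row with `Z₊ = 18` (the twelve flag-rail eighteens) has all four twisted letter windows ANTI-oriented (certified neighbourhoods: no nineteen near them),
and the only rows with all four windows oriented are the 26 pseudo-nineteen-rail seventeens on `(0,2,5,N)` / `(0,3,7,N)` (`V = 19`); the general real nineteen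
`G3K4E1` has all four windows oriented, as the theorem demands.

Nothing here bounds `ζ_sym(3,4)`; `DoorA34` and the three stubs stay OPEN; registers unchanged (`ζ_sym(3,4) ∈ {18,19}`); nothing on `MatrixDescartes`
(stmt-ValiantsHypothesis-18050) or on `VP ≠ VNP` — VP≠VNP not moved.  [folklore] Rolle twists + Descartes sharpness + the Gram orientation principle; no single source.
-/

-- `Summit.ValiantsHypothesis.ValiantsHypothesis.…` repeats a component by the D-0017 layout
-- (single-conjunct summit), which the `dupNamespace` linter flags; the name is mandated.
set_option linter.dupNamespace false

namespace Summit.ValiantsHypothesis.ValiantsHypothesis.Theorems.LacunarySymmetroidMatrixDescartes.Census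

open Polynomial Finset
open scoped BigOperators Polynomial Matrix

/-! ## 1. Five roots of a twisted letter window of a null-top eighteen -/

/-- **FIVE ROOTS OF A TWISTED LETTER WINDOW OF A NULL-TOP EIGHTEEN.**  Any real `3 × 3` letters, any `d`; letters `k, p, q, r` with `d_q = d_p + a`,
`d_r = d_p + b`, `0 < a < b`, `2a ≠ b`, `k ∉ {p,q,r}`; sorted support, `det S₃ = 0`, `18` distinct positive roots.  With `W(n) = ∏ (n − σ(u))` over the exponents of the thirteen sheet slots outside the `k`-window and
`c̃ᵢ = W(e)·coeff(e)` at `e = 2d_p + d_k, d_p+d_q+d_k, 2d_q+d_k, d_p+d_r+d_k, d_q+d_r+d_k, 2d_r+d_k`, the six-nomial `c̃₀ + c̃₁x^a + c̃₂x^{2a} + c̃₃x^b + c̃₄x^{a+b} + c̃₅x^{2b}` has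
at least five distinct positive roots. [folklore] -/
theorem sheetLetterWindow_five_roots_of_nullTop_eighteen (d : Fin 4 → ℕ) (S : Fin 4 → Matrix (Fin 3) (Fin 3) ℝ)
    (h3 : (S 3).det = 0)
    (h18 : 18 ≤ ((Matrix.det (∑ l, ((X : ℝ[X]) ^ d l) • (S l).map C)).roots.toFinset.filter (fun t => 0 < t)).card)
    (k p q r : Fin 4) (hkp : k ≠ p) (hkq : k ≠ q) (hkr : k ≠ r)
    {a b : ℕ} (ha : d q = d p + a) (hb : d r = d p + b) (ha0 : 0 < a) (hab : a < b) (h2ab : 2 * a ≠ b)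
    (W : ℕ → ℝ) (hW : ∀ n, W n =
      ∏ E ∈ ((((Finset.univ : Finset (Sym (Fin 4) 3)).erase (Sym.replicate 3 3)) \
          ({⟨{k, p, p}, by simp⟩, ⟨{k, p, q}, by simp⟩, ⟨{k, q, q}, by simp⟩, ⟨{k, p, r}, by simp⟩, ⟨{k, q, r}, by simp⟩, ⟨{k, r, r}, by simp⟩} :
            Finset (Sym (Fin 4) 3))).image
          (fun s : Sym (Fin 4) 3 => ((s : Multiset (Fin 4)).map d).sum)).image (fun m : ℕ => (m : ℝ)), ((n : ℝ) - E))
    (c₀ c₁ c₂ c₃ c₄ c₅ : ℝ)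
    (hc₀ : c₀ = W (2 * d p + d k) * (Matrix.det (∑ l, ((X : ℝ[X]) ^ d l) • (S l).map C)).coeff (2 * d p + d k))
    (hc₁ : c₁ = W (d p + d q + d k) * (Matrix.det (∑ l, ((X : ℝ[X]) ^ d l) • (S l).map C)).coeff (d p + d q + d k))
    (hc₂ : c₂ = W (2 * d q + d k) * (Matrix.det (∑ l, ((X : ℝ[X]) ^ d l) • (S l).map C)).coeff (2 * d q + d k))
    (hc₃ : c₃ = W (d p + d r + d k) * (Matrix.det (∑ l, ((X : ℝ[X]) ^ d l) • (S l).map C)).coeff (d p + d r + d k))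
    (hc₄ : c₄ = W (d q + d r + d k) * (Matrix.det (∑ l, ((X : ℝ[X]) ^ d l) • (S l).map C)).coeff (d q + d r + d k))
    (hc₅ : c₅ = W (2 * d r + d k) * (Matrix.det (∑ l, ((X : ℝ[X]) ^ d l) • (S l).map C)).coeff (2 * d r + d k)) :
    5 ≤ (((C c₀ * X ^ 0 + C c₁ * X ^ a + C c₂ * X ^ (2 * a) + C c₃ * X ^ b + C c₄ * X ^ (a + b) + C c₅ * X ^ (2 * b) : ℝ[X])).roots.toFinset.filter
      (fun t => 0 < t)).card := by
  set B : Finset (Sym (Fin 4) 3) :=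
    {⟨{k, p, p}, by simp⟩, ⟨{k, p, q}, by simp⟩, ⟨{k, q, q}, by simp⟩, ⟨{k, p, r}, by simp⟩, ⟨{k, q, r}, by simp⟩, ⟨{k, r, r}, by simp⟩} with hB
  have hBsub : B ⊆ (Finset.univ : Finset (Sym (Fin 4) 3)).erase (Sym.replicate 3 3) := by
    intro s hs
    rw [Finset.mem_erase]
    refine ⟨?_, Finset.mem_univ _⟩
    rw [hB] at hs
    simp only [Finset.mem_insert, Finset.mem_singleton] at hs
    have key : ∀ (m : Multiset (Fin 4)) (hm : Multiset.card m = 3), k ∈ m → (p ∈ m ∨ q ∈ m ∨ r ∈ m) →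
        (⟨m, hm⟩ : Sym (Fin 4) 3) ≠ Sym.replicate 3 3 := by
      intro m hm hkm hpm e
      have hm3 : m = Multiset.replicate 3 (3 : Fin 4) := by
        simpa [Sym.coe_replicate] using congrArg (fun u : Sym (Fin 4) 3 => (u : Multiset (Fin 4))) e
      rw [hm3] at hkm hpm
      have hk3 := Multiset.eq_of_mem_replicate hkm
      rcases hpm with h | h | h
      · exact hkp (hk3.trans (Multiset.eq_of_mem_replicate h).symm)
      · exact hkq (hk3.trans (Multiset.eq_of_mem_replicate h).symm)
      · exact hkr (hk3.trans (Multiset.eq_of_mem_replicate h).symm)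
    rcases hs with rfl | rfl | rfl | rfl | rfl | rfl <;> exact key _ _ (by simp) (by simp)
  obtain ⟨g, hg, hsupp, hZ⟩ := twistedSubword_sharp_of_nullTop_eighteen d S h3 h18 B hBsub ⟨_, Finset.mem_insert_self _ _⟩
  -- the window's exponents
  have hmemB : ∀ n ∈ g.support, n = 2 * d p + d k ∨ n = d p + d q + d k ∨ n = 2 * d q + d k ∨ n = d p + d r + d k
      ∨ n = d q + d r + d k ∨ n = 2 * d r + d k := by
    intro n hn
    have h := hsupp hn
    rw [hB] at h
    simp only [Finset.image_insert, Finset.image_singleton, Finset.mem_insert, Finset.mem_singleton, Sym.coe_mk,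
      Multiset.insert_eq_cons, Multiset.map_cons, Multiset.sum_cons, Multiset.map_singleton, Multiset.sum_singleton] at h
    omega
  -- `B` has six elements (its six exponents are distinct)
  have h6 : 6 ≤ B.card := by
    have hsub : ({2 * d p + d k, d p + d q + d k, 2 * d q + d k, d p + d r + d k, d q + d r + d k, 2 * d r + d k} : Finset ℕ)
        ⊆ B.image (fun s : Sym (Fin 4) 3 => ((s : Multiset (Fin 4)).map d).sum) := by
      intro n hn
      rw [hB]
      simp only [Finset.image_insert, Finset.image_singleton, Finset.mem_insert, Finset.mem_singleton, Sym.coe_mk,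
        Multiset.insert_eq_cons, Multiset.map_cons, Multiset.sum_cons, Multiset.map_singleton, Multiset.sum_singleton]
      simp only [Finset.mem_insert, Finset.mem_singleton] at hn
      omega
    have hc : ({2 * d p + d k, d p + d q + d k, 2 * d q + d k, d p + d r + d k, d q + d r + d k, 2 * d r + d k} : Finset ℕ).card = 6 := by
      rw [Finset.card_insert_of_notMem, Finset.card_insert_of_notMem, Finset.card_insert_of_notMem, Finset.card_insert_of_notMem,
        Finset.card_insert_of_notMem, Finset.card_singleton] <;>
        simp only [Finset.mem_insert, Finset.mem_singleton] <;> omega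
    calc 6 = _ := hc.symm
      _ ≤ (B.image (fun s : Sym (Fin 4) 3 => ((s : Multiset (Fin 4)).map d).sum)).card := Finset.card_le_card hsub
      _ ≤ B.card := Finset.card_image_le
  -- coefficients of `g`
  have hcoef : ∀ n, g.coeff n = W n * (Matrix.det (∑ l, ((X : ℝ[X]) ^ d l) • (S l).map C)).coeff n := by
    intro n; rw [hg, hW]
  have e1 : d p + d q + d k = 2 * d p + d k + a := by omega
  have e2 : 2 * d q + d k = 2 * d p + d k + 2 * a := by omega
  have e3 : d p + d r + d k = 2 * d p + d k + b := by omega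
  have e4 : d q + d r + d k = 2 * d p + d k + (a + b) := by omega
  have e5 : 2 * d r + d k = 2 * d p + d k + 2 * b := by omega
  -- `g` is the monomial `X^{2d_p + d_k}` times the six-nomial
  have hgeq : g = X ^ (2 * d p + d k) *
      (C c₀ * X ^ 0 + C c₁ * X ^ a + C c₂ * X ^ (2 * a) + C c₃ * X ^ b + C c₄ * X ^ (a + b) + C c₅ * X ^ (2 * b)) := by
    have hg6 : g = C c₀ * X ^ (2 * d p + d k) + C c₁ * X ^ (2 * d p + d k + a) + C c₂ * X ^ (2 * d p + d k + 2 * a)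
        + C c₃ * X ^ (2 * d p + d k + b) + C c₄ * X ^ (2 * d p + d k + (a + b)) + C c₅ * X ^ (2 * d p + d k + 2 * b) := by
      ext n
      simp only [coeff_add, coeff_C_mul, coeff_X_pow]
      by_cases h0 : n = 2 * d p + d k
      · subst h0
        rw [hcoef, ← hc₀, if_pos rfl, if_neg (by omega), if_neg (by omega), if_neg (by omega), if_neg (by omega), if_neg (by omega)]
        ring
      by_cases h1 : n = 2 * d p + d k + a
      · subst h1
        rw [hcoef, ← e1, ← hc₁, if_neg (by omega), e1, if_pos rfl, if_neg (by omega), if_neg (by omega), if_neg (by omega),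
          if_neg (by omega)]
        ring
      by_cases h2 : n = 2 * d p + d k + 2 * a
      · subst h2
        rw [hcoef, ← e2, ← hc₂, if_neg (by omega), if_neg (by omega), e2, if_pos rfl, if_neg (by omega), if_neg (by omega),
          if_neg (by omega)]
        ring
      by_cases h3 : n = 2 * d p + d k + b
      · subst h3
        rw [hcoef, ← e3, ← hc₃, if_neg (by omega), if_neg (by omega), if_neg (by omega), e3, if_pos rfl, if_neg (by omega),
          if_neg (by omega)]
        ring
      by_cases h4 : n = 2 * d p + d k + (a + b)
      · subst h4
        rw [hcoef, ← e4, ← hc₄, if_neg (by omega), if_neg (by omega), if_neg (by omega), if_neg (by omega), e4, if_pos rfl,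
          if_neg (by omega)]
        ring
      by_cases h5 : n = 2 * d p + d k + 2 * b
      · subst h5
        rw [hcoef, ← e5, ← hc₅, if_neg (by omega), if_neg (by omega), if_neg (by omega), if_neg (by omega), if_neg (by omega),
          e5, if_pos rfl]
        ring
      have hn : n ∉ g.support := fun hn => by
        rcases hmemB n hn with h | h | h | h | h | h <;> omega
      rw [notMem_support_iff.mp hn, if_neg h0, if_neg h1, if_neg h2, if_neg h3, if_neg h4, if_neg h5]
      ring
    rw [hg6]
    simp only [pow_add, pow_zero, mul_one]
    ring
  have hq : (C c₀ * X ^ 0 + C c₁ * X ^ a + C c₂ * X ^ (2 * a) + C c₃ * X ^ b + C c₄ * X ^ (a + b) + C c₅ * X ^ (2 * b) : ℝ[X]) ≠ 0 := by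
    intro hq
    rw [hgeq, hq, mul_zero, roots_zero, Multiset.toFinset_zero, Finset.filter_empty, Finset.card_empty] at hZ
    omega
  rw [hgeq, posRoots_X_pow_mul (2 * d p + d k) _ hq] at hZ
  omega

/-! ## 2. Gram orientation of the twisted letter windows on the sheet -/

/-- **TWISTED LETTER WINDOW OF A NULL-TOP EIGHTEEN, WINDOW SHAPE (`2a < b`): Gram-oriented** — `0 < c̃₅Δ̃ ∧ c̃₀Δ̃ < 0 ∧ c̃₂Δ̃ < 0`. [folklore] -/
theorem sheetLetterWindow_gram_orientation_of_nullTop_eighteen (d : Fin 4 → ℕ) (S : Fin 4 → Matrix (Fin 3) (Fin 3) ℝ)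
    (h3 : (S 3).det = 0)
    (h18 : 18 ≤ ((Matrix.det (∑ l, ((X : ℝ[X]) ^ d l) • (S l).map C)).roots.toFinset.filter (fun t => 0 < t)).card)
    (k p q r : Fin 4) (hkp : k ≠ p) (hkq : k ≠ q) (hkr : k ≠ r)
    {a b : ℕ} (ha : d q = d p + a) (hb : d r = d p + b) (ha0 : 0 < a) (hw : 2 * a < b)
    (W : ℕ → ℝ) (hW : ∀ n, W n =
      ∏ E ∈ ((((Finset.univ : Finset (Sym (Fin 4) 3)).erase (Sym.replicate 3 3)) \
          ({⟨{k, p, p}, by simp⟩, ⟨{k, p, q}, by simp⟩, ⟨{k, q, q}, by simp⟩, ⟨{k, p, r}, by simp⟩, ⟨{k, q, r}, by simp⟩, ⟨{k, r, r}, by simp⟩} :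
            Finset (Sym (Fin 4) 3))).image
          (fun s : Sym (Fin 4) 3 => ((s : Multiset (Fin 4)).map d).sum)).image (fun m : ℕ => (m : ℝ)), ((n : ℝ) - E))
    (c₀ c₁ c₂ c₃ c₄ c₅ : ℝ)
    (hc₀ : c₀ = W (2 * d p + d k) * (Matrix.det (∑ l, ((X : ℝ[X]) ^ d l) • (S l).map C)).coeff (2 * d p + d k))
    (hc₁ : c₁ = W (d p + d q + d k) * (Matrix.det (∑ l, ((X : ℝ[X]) ^ d l) • (S l).map C)).coeff (d p + d q + d k))
    (hc₂ : c₂ = W (2 * d q + d k) * (Matrix.det (∑ l, ((X : ℝ[X]) ^ d l) • (S l).map C)).coeff (2 * d q + d k))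
    (hc₃ : c₃ = W (d p + d r + d k) * (Matrix.det (∑ l, ((X : ℝ[X]) ^ d l) • (S l).map C)).coeff (d p + d r + d k))
    (hc₄ : c₄ = W (d q + d r + d k) * (Matrix.det (∑ l, ((X : ℝ[X]) ^ d l) • (S l).map C)).coeff (d q + d r + d k))
    (hc₅ : c₅ = W (2 * d r + d k) * (Matrix.det (∑ l, ((X : ℝ[X]) ^ d l) • (S l).map C)).coeff (2 * d r + d k)) :
    0 < c₅ * (c₀ * c₂ * c₅ + c₁ * c₃ * c₄ / 4 - c₀ * c₄ ^ 2 / 4 - c₂ * c₃ ^ 2 / 4 - c₅ * c₁ ^ 2 / 4)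
      ∧ c₀ * (c₀ * c₂ * c₅ + c₁ * c₃ * c₄ / 4 - c₀ * c₄ ^ 2 / 4 - c₂ * c₃ ^ 2 / 4 - c₅ * c₁ ^ 2 / 4) < 0
      ∧ c₂ * (c₀ * c₂ * c₅ + c₁ * c₃ * c₄ / 4 - c₀ * c₄ ^ 2 / 4 - c₂ * c₃ ^ 2 / 4 - c₅ * c₁ ^ 2 / 4) < 0 :=
  orientation_eq_sign_gramDet a b ha0 hw c₀ c₁ c₂ c₃ c₄ c₅
    (sheetLetterWindow_five_roots_of_nullTop_eighteen d S h3 h18 k p q r hkp hkq hkr ha hb ha0 (by omega) (by omega) W hW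
      c₀ c₁ c₂ c₃ c₄ c₅ hc₀ hc₁ hc₂ hc₃ hc₄ hc₅)

/-- **TWISTED LETTER WINDOW OF A NULL-TOP EIGHTEEN, MIRROR SHAPE (`a < b < 2a`): Gram-oriented the other way** — `0 < c̃₀Δ̃ ∧ c̃₅Δ̃ < 0 ∧ c̃₂Δ̃ < 0`. [folklore] -/
theorem sheetLetterWindow_gram_orientation_of_nullTop_eighteen_mirror (d : Fin 4 → ℕ) (S : Fin 4 → Matrix (Fin 3) (Fin 3) ℝ)
    (h3 : (S 3).det = 0)
    (h18 : 18 ≤ ((Matrix.det (∑ l, ((X : ℝ[X]) ^ d l) • (S l).map C)).roots.toFinset.filter (fun t => 0 < t)).card)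
    (k p q r : Fin 4) (hkp : k ≠ p) (hkq : k ≠ q) (hkr : k ≠ r)
    {a b : ℕ} (ha : d q = d p + a) (hb : d r = d p + b) (hab : a < b) (hnw : b < 2 * a)
    (W : ℕ → ℝ) (hW : ∀ n, W n =
      ∏ E ∈ ((((Finset.univ : Finset (Sym (Fin 4) 3)).erase (Sym.replicate 3 3)) \
          ({⟨{k, p, p}, by simp⟩, ⟨{k, p, q}, by simp⟩, ⟨{k, q, q}, by simp⟩, ⟨{k, p, r}, by simp⟩, ⟨{k, q, r}, by simp⟩, ⟨{k, r, r}, by simp⟩} :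
            Finset (Sym (Fin 4) 3))).image
          (fun s : Sym (Fin 4) 3 => ((s : Multiset (Fin 4)).map d).sum)).image (fun m : ℕ => (m : ℝ)), ((n : ℝ) - E))
    (c₀ c₁ c₂ c₃ c₄ c₅ : ℝ)
    (hc₀ : c₀ = W (2 * d p + d k) * (Matrix.det (∑ l, ((X : ℝ[X]) ^ d l) • (S l).map C)).coeff (2 * d p + d k))
    (hc₁ : c₁ = W (d p + d q + d k) * (Matrix.det (∑ l, ((X : ℝ[X]) ^ d l) • (S l).map C)).coeff (d p + d q + d k))
    (hc₂ : c₂ = W (2 * d q + d k) * (Matrix.det (∑ l, ((X : ℝ[X]) ^ d l) • (S l).map C)).coeff (2 * d q + d k))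
    (hc₃ : c₃ = W (d p + d r + d k) * (Matrix.det (∑ l, ((X : ℝ[X]) ^ d l) • (S l).map C)).coeff (d p + d r + d k))
    (hc₄ : c₄ = W (d q + d r + d k) * (Matrix.det (∑ l, ((X : ℝ[X]) ^ d l) • (S l).map C)).coeff (d q + d r + d k))
    (hc₅ : c₅ = W (2 * d r + d k) * (Matrix.det (∑ l, ((X : ℝ[X]) ^ d l) • (S l).map C)).coeff (2 * d r + d k)) :
    0 < c₀ * (c₀ * c₂ * c₅ + c₁ * c₃ * c₄ / 4 - c₀ * c₄ ^ 2 / 4 - c₂ * c₃ ^ 2 / 4 - c₅ * c₁ ^ 2 / 4)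
      ∧ c₅ * (c₀ * c₂ * c₅ + c₁ * c₃ * c₄ / 4 - c₀ * c₄ ^ 2 / 4 - c₂ * c₃ ^ 2 / 4 - c₅ * c₁ ^ 2 / 4) < 0
      ∧ c₂ * (c₀ * c₂ * c₅ + c₁ * c₃ * c₄ / 4 - c₀ * c₄ ^ 2 / 4 - c₂ * c₃ ^ 2 / 4 - c₅ * c₁ ^ 2 / 4) < 0 := by
  have ha0 : 0 < a := by omega
  exact orientation_eq_sign_gramDet_mirror a b hab hnw c₀ c₁ c₂ c₃ c₄ c₅
    (sheetLetterWindow_five_roots_of_nullTop_eighteen d S h3 h18 k p q r hkp hkq hkr ha hb ha0 hab (by omega) W hW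
      c₀ c₁ c₂ c₃ c₄ c₅ hc₀ hc₁ hc₂ hc₃ hc₄ hc₅)

/-! ## 3. The window coefficients of a null-top eighteen in letters -/

/-- **Letter window coefficients of a null-top eighteen** (sorted support, any real letters; rows `coeff_square/mixed_of_nullTop_eighteen`):
the six coefficients of the `k`-window are `tr(adj S_p·S_k)`, `tr(B(S_p,S_q)·S_k)`, `tr(adj S_q·S_k)`, `tr(B(S_p,S_r)·S_k)`, `tr(B(S_q,S_r)·S_k)`, `tr(adj S_r·S_k)`,
`B(X,Y) = adj(X+Y) − adj X − adj Y`. [folklore] -/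
theorem sheetLetterWindow_coeffs_eq_traces_of_nullTop_eighteen (d : Fin 4 → ℕ) (hd : StrictMono d) (S : Fin 4 → Matrix (Fin 3) (Fin 3) ℝ)
    (h3 : (S 3).det = 0)
    (h18 : 18 ≤ ((Matrix.det (∑ l, ((X : ℝ[X]) ^ d l) • (S l).map C)).roots.toFinset.filter (fun t => 0 < t)).card)
    (k p q r : Fin 4) (hkp : k ≠ p) (hkq : k ≠ q) (hkr : k ≠ r) (hpq : p ≠ q) (hpr : p ≠ r) (hqr : q ≠ r) :
    (Matrix.det (∑ l, ((X : ℝ[X]) ^ d l) • (S l).map C)).coeff (2 * d p + d k) = ((S p).adjugate * S k).trace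
      ∧ (Matrix.det (∑ l, ((X : ℝ[X]) ^ d l) • (S l).map C)).coeff (d p + d q + d k)
          = (((S p + S q).adjugate - (S p).adjugate - (S q).adjugate) * S k).trace
      ∧ (Matrix.det (∑ l, ((X : ℝ[X]) ^ d l) • (S l).map C)).coeff (2 * d q + d k) = ((S q).adjugate * S k).trace
      ∧ (Matrix.det (∑ l, ((X : ℝ[X]) ^ d l) • (S l).map C)).coeff (d p + d r + d k)
          = (((S p + S r).adjugate - (S p).adjugate - (S r).adjugate) * S k).trace
      ∧ (Matrix.det (∑ l, ((X : ℝ[X]) ^ d l) • (S l).map C)).coeff (d q + d r + d k)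
          = (((S q + S r).adjugate - (S q).adjugate - (S r).adjugate) * S k).trace
      ∧ (Matrix.det (∑ l, ((X : ℝ[X]) ^ d l) • (S l).map C)).coeff (2 * d r + d k) = ((S r).adjugate * S k).trace :=
  ⟨(coeff_square_of_nullTop_eighteen d hd S h3 h18 p k (Ne.symm hkp)).1,
    (coeff_mixed_of_nullTop_eighteen d hd S h3 h18 p q k hpq (Ne.symm hkp) (Ne.symm hkq)).1,
    (coeff_square_of_nullTop_eighteen d hd S h3 h18 q k (Ne.symm hkq)).1,
    (coeff_mixed_of_nullTop_eighteen d hd S h3 h18 p r k hpr (Ne.symm hkp) (Ne.symm hkr)).1,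
    (coeff_mixed_of_nullTop_eighteen d hd S h3 h18 q r k hqr (Ne.symm hkq) (Ne.symm hkr)).1,
    (coeff_square_of_nullTop_eighteen d hd S h3 h18 r k (Ne.symm hkr)).1⟩

/-! ## 4. The certificates: the anti-oriented regions of the four letter windows of the sheet carry no eighteen -/

/-- **SHEET CERTIFICATE (window shape `2a < b`).**  Sorted support, any real `3 × 3` letters, `det S₃ = 0`, letters `k, p, q, r` pairwise distinct with
`d_q = d_p + a`, `d_r = d_p + b`, `0 < a`, `2a < b`.  With `W(n) = ∏ (n − σ(u))` over the exponents of the thirteen sheet slots outside the `k`-window and the LETTER data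
`c̃ = W·(tr(adj S_p·S_k), tr(B(S_p,S_q)·S_k), tr(adj S_q·S_k), tr(B(S_p,S_r)·S_k), tr(B(S_q,S_r)·S_k), tr(adj S_r·S_k))`: if the twisted `k`-window is NOT
Gram-oriented, `c̃₅·Δ̃ ≤ 0`, the pencil has at most `17` distinct positive roots. [folklore] -/
theorem posRoots_le_17_of_nullTop_of_twistedLetterWindow_antiOriented (d : Fin 4 → ℕ) (hd : StrictMono d) (S : Fin 4 → Matrix (Fin 3) (Fin 3) ℝ)
    (h3 : (S 3).det = 0)
    (k p q r : Fin 4) (hkp : k ≠ p) (hkq : k ≠ q) (hkr : k ≠ r) (hpq : p ≠ q) (hpr : p ≠ r) (hqr : q ≠ r)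
    {a b : ℕ} (ha : d q = d p + a) (hb : d r = d p + b) (ha0 : 0 < a) (hw : 2 * a < b)
    (W : ℕ → ℝ) (hW : ∀ n, W n =
      ∏ E ∈ ((((Finset.univ : Finset (Sym (Fin 4) 3)).erase (Sym.replicate 3 3)) \
          ({⟨{k, p, p}, by simp⟩, ⟨{k, p, q}, by simp⟩, ⟨{k, q, q}, by simp⟩, ⟨{k, p, r}, by simp⟩, ⟨{k, q, r}, by simp⟩, ⟨{k, r, r}, by simp⟩} :
            Finset (Sym (Fin 4) 3))).image
          (fun s : Sym (Fin 4) 3 => ((s : Multiset (Fin 4)).map d).sum)).image (fun m : ℕ => (m : ℝ)), ((n : ℝ) - E))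
    (c₀ c₁ c₂ c₃ c₄ c₅ : ℝ)
    (hc₀ : c₀ = W (2 * d p + d k) * ((S p).adjugate * S k).trace)
    (hc₁ : c₁ = W (d p + d q + d k) * (((S p + S q).adjugate - (S p).adjugate - (S q).adjugate) * S k).trace)
    (hc₂ : c₂ = W (2 * d q + d k) * ((S q).adjugate * S k).trace)
    (hc₃ : c₃ = W (d p + d r + d k) * (((S p + S r).adjugate - (S p).adjugate - (S r).adjugate) * S k).trace)
    (hc₄ : c₄ = W (d q + d r + d k) * (((S q + S r).adjugate - (S q).adjugate - (S r).adjugate) * S k).trace)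
    (hc₅ : c₅ = W (2 * d r + d k) * ((S r).adjugate * S k).trace)
    (hanti : c₅ * (c₀ * c₂ * c₅ + c₁ * c₃ * c₄ / 4 - c₀ * c₄ ^ 2 / 4 - c₂ * c₃ ^ 2 / 4 - c₅ * c₁ ^ 2 / 4) ≤ 0) :
    ((Matrix.det (∑ l, ((X : ℝ[X]) ^ d l) • (S l).map C)).roots.toFinset.filter (fun t => 0 < t)).card ≤ 17 := by
  by_contra hlt
  have h18 : 18 ≤ ((Matrix.det (∑ l, ((X : ℝ[X]) ^ d l) • (S l).map C)).roots.toFinset.filter (fun t => 0 < t)).card := by omega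
  obtain ⟨e0, e1, e2, e3, e4, e5⟩ := sheetLetterWindow_coeffs_eq_traces_of_nullTop_eighteen d hd S h3 h18 k p q r hkp hkq hkr hpq hpr hqr
  have h := (sheetLetterWindow_gram_orientation_of_nullTop_eighteen d S h3 h18 k p q r hkp hkq hkr ha hb ha0 hw W hW c₀ c₁ c₂ c₃ c₄ c₅
    (by rw [e0]; exact hc₀) (by rw [e1]; exact hc₁) (by rw [e2]; exact hc₂) (by rw [e3]; exact hc₃) (by rw [e4]; exact hc₄)
    (by rw [e5]; exact hc₅)).1
  linarith

/-- **SHEET CERTIFICATE (mirror shape `a < b < 2a`).**  Same letter data; if `c̃₀·Δ̃ ≤ 0` then at most `17` distinct positive roots. [folklore] -/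
theorem posRoots_le_17_of_nullTop_of_twistedLetterWindow_antiOriented_mirror (d : Fin 4 → ℕ) (hd : StrictMono d) (S : Fin 4 → Matrix (Fin 3) (Fin 3) ℝ)
    (h3 : (S 3).det = 0)
    (k p q r : Fin 4) (hkp : k ≠ p) (hkq : k ≠ q) (hkr : k ≠ r) (hpq : p ≠ q) (hpr : p ≠ r) (hqr : q ≠ r)
    {a b : ℕ} (ha : d q = d p + a) (hb : d r = d p + b) (hab : a < b) (hnw : b < 2 * a)
    (W : ℕ → ℝ) (hW : ∀ n, W n =
      ∏ E ∈ ((((Finset.univ : Finset (Sym (Fin 4) 3)).erase (Sym.replicate 3 3)) \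
          ({⟨{k, p, p}, by simp⟩, ⟨{k, p, q}, by simp⟩, ⟨{k, q, q}, by simp⟩, ⟨{k, p, r}, by simp⟩, ⟨{k, q, r}, by simp⟩, ⟨{k, r, r}, by simp⟩} :
            Finset (Sym (Fin 4) 3))).image
          (fun s : Sym (Fin 4) 3 => ((s : Multiset (Fin 4)).map d).sum)).image (fun m : ℕ => (m : ℝ)), ((n : ℝ) - E))
    (c₀ c₁ c₂ c₃ c₄ c₅ : ℝ)
    (hc₀ : c₀ = W (2 * d p + d k) * ((S p).adjugate * S k).trace)
    (hc₁ : c₁ = W (d p + d q + d k) * (((S p + S q).adjugate - (S p).adjugate - (S q).adjugate) * S k).trace)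
    (hc₂ : c₂ = W (2 * d q + d k) * ((S q).adjugate * S k).trace)
    (hc₃ : c₃ = W (d p + d r + d k) * (((S p + S r).adjugate - (S p).adjugate - (S r).adjugate) * S k).trace)
    (hc₄ : c₄ = W (d q + d r + d k) * (((S q + S r).adjugate - (S q).adjugate - (S r).adjugate) * S k).trace)
    (hc₅ : c₅ = W (2 * d r + d k) * ((S r).adjugate * S k).trace)
    (hanti : c₀ * (c₀ * c₂ * c₅ + c₁ * c₃ * c₄ / 4 - c₀ * c₄ ^ 2 / 4 - c₂ * c₃ ^ 2 / 4 - c₅ * c₁ ^ 2 / 4) ≤ 0) :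
    ((Matrix.det (∑ l, ((X : ℝ[X]) ^ d l) • (S l).map C)).roots.toFinset.filter (fun t => 0 < t)).card ≤ 17 := by
  by_contra hlt
  have h18 : 18 ≤ ((Matrix.det (∑ l, ((X : ℝ[X]) ^ d l) • (S l).map C)).roots.toFinset.filter (fun t => 0 < t)).card := by omega
  obtain ⟨e0, e1, e2, e3, e4, e5⟩ := sheetLetterWindow_coeffs_eq_traces_of_nullTop_eighteen d hd S h3 h18 k p q r hkp hkq hkr hpq hpr hqr
  have h := (sheetLetterWindow_gram_orientation_of_nullTop_eighteen_mirror d S h3 h18 k p q r hkp hkq hkr ha hb hab hnw W hW c₀ c₁ c₂ c₃ c₄ c₅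
    (by rw [e0]; exact hc₀) (by rw [e1]; exact hc₁) (by rw [e2]; exact hc₂) (by rw [e3]; exact hc₃) (by rw [e4]; exact hc₄)
    (by rw [e5]; exact hc₅)).1
  linarith

end Summit.ValiantsHypothesis.ValiantsHypothesis.Theorems.LacunarySymmetroidMatrixDescartes.Census
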